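import Summits.Parity.GeneralizedHardyLittlewood.Theorems.GreenTaoLevelTwoGITwoCyclicInverseBohrDoubling
import Mathlib.Analysis.SpecialFunctions.Complex.CircleAddChar
import Mathlib.Analysis.SpecialFunctions.Trigonometric.Bounds

/-!
# Route `GreenTaoLevelTwo`, crux `GITwo` (stmt-Parity-21275), line `birth`, stub `stub_cyclicInverse`:
# the character of `ℝ/ℤ` is `2π`-Lipschitz (phase-replacement step of GT08a §9 Step 3)

Forty-eighth helper file toward the XL stub `stub_cyclicInverse` (B. Green, T. Tao, *An inverse
theorem for the Gowers `U³(G)` norm*, arXiv:math/0503014, Thm. 68 = PEMS 51 (2008) Thm. 12.8).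
Block C13, §9 Step 3: "by (symm-2), `|e(−2Mh·x) − b(x+h) b(h) e(Mx·x)| ≤ 2π · 2^{C₇}η^{−C'₇}ε₄`" —
the only analytic input is that `e : ℝ/ℤ → ℂ` is `2π`-Lipschitz.  Def-free, for the characters used
in the sibling files (`AddCircle.toCircle` on `UnitAddCircle`, `ZMod.stdAddChar` on `ℤ/Nℤ`):

* `norm_toCircle_sub_one_le` — `‖e(θ) − 1‖ ≤ 2π ‖θ‖_{ℝ/ℤ}`;
* `norm_toCircle_sub_toCircle_le` — `‖e(θ₁) − e(θ₂)‖ ≤ 2π ‖θ₁ − θ₂‖_{ℝ/ℤ}`;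
* `norm_stdAddChar_sub_stdAddChar_le` — `‖e(a/N) − e(b/N)‖ ≤ 2π ‖toAddCircle(a − b)‖`.

References: [GreenTao2008U3Inverse] arXiv:math/0503014, §9 Step 3.
-/

noncomputable section

namespace Summit.Parity.GeneralizedHardyLittlewood.GreenTaoLevelTwoGITwoCyclicInverse

open Finset

/-- `‖e(θ) − 1‖ ≤ 2π‖θ‖_{ℝ/ℤ}` for the character `e = AddCircle.toCircle` of `ℝ/ℤ`. [folklore] -/
theorem norm_toCircle_sub_one_le (θ : UnitAddCircle) :
    ‖((AddCircle.toCircle θ : Circle) : ℂ) - 1‖ ≤ 2 * Real.pi * ‖θ‖ := by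
  -- choose the lift `t = x − round x` of a representative `x`
  obtain ⟨x, rfl⟩ := QuotientAddGroup.mk_surjective θ
  set t : ℝ := x - round x with ht
  have hθt : ((x : ℝ) : UnitAddCircle) = ((t : ℝ) : UnitAddCircle) := by
    rw [ht, AddCircle.coe_sub]
    have : ((round x : ℝ) : UnitAddCircle) = 0 := by
      rw [AddCircle.coe_eq_zero_iff]
      exact ⟨round x, by simp⟩
    rw [this, sub_zero]
  have hnorm : ‖((x : ℝ) : UnitAddCircle)‖ = |t| := by
    rw [UnitAddCircle.norm_eq, ht]
  rw [hθt, AddCircle.toCircle_apply_mk, Circle.coe_exp, ← hθt, hnorm]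
  have h := Real.norm_exp_I_mul_ofReal_sub_one_le (x := 2 * Real.pi * t)
  rw [Real.norm_eq_abs, abs_mul, abs_of_pos Real.two_pi_pos] at h
  have e : Complex.exp (((2 * Real.pi / 1 * t : ℝ) : ℂ) * Complex.I) =
      Complex.exp (Complex.I * ((2 * Real.pi * t : ℝ) : ℂ)) := by
    congr 1; push_cast; ring
  rw [e]
  exact h

/-- `‖e(θ₁) − e(θ₂)‖ ≤ 2π ‖θ₁ − θ₂‖_{ℝ/ℤ}`. [folklore] -/
theorem norm_toCircle_sub_toCircle_le (θ₁ θ₂ : UnitAddCircle) :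
    ‖((AddCircle.toCircle θ₁ : Circle) : ℂ) - ((AddCircle.toCircle θ₂ : Circle) : ℂ)‖ ≤
      2 * Real.pi * ‖θ₁ - θ₂‖ := by
  have h1 : ((AddCircle.toCircle θ₁ : Circle) : ℂ) =
      ((AddCircle.toCircle θ₂ : Circle) : ℂ) * ((AddCircle.toCircle (θ₁ - θ₂) : Circle) : ℂ) := by
    rw [← Circle.coe_mul, ← AddCircle.toCircle_add, add_sub_cancel]
  rw [h1, ← mul_sub_one, norm_mul, Circle.norm_coe, one_mul]
  exact norm_toCircle_sub_one_le _

variable {N : ℕ} [NeZero N]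

/-- `‖e(a/N) − e(b/N)‖ ≤ 2π ‖toAddCircle(a − b)‖_{ℝ/ℤ}` for the standard character of `ℤ/Nℤ`.
[folklore] -/
theorem norm_stdAddChar_sub_stdAddChar_le (a b : ZMod N) :
    ‖(ZMod.stdAddChar a : ℂ) - ZMod.stdAddChar b‖ ≤ 2 * Real.pi * ‖ZMod.toAddCircle (a - b)‖ := by
  have ha : (ZMod.stdAddChar a : ℂ) = ((AddCircle.toCircle (ZMod.toAddCircle a) : Circle) : ℂ) := rfl
  have hb : (ZMod.stdAddChar b : ℂ) = ((AddCircle.toCircle (ZMod.toAddCircle b) : Circle) : ℂ) := rfl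
  rw [ha, hb, map_sub]
  exact norm_toCircle_sub_toCircle_le _ _

end Summit.Parity.GeneralizedHardyLittlewood.GreenTaoLevelTwoGITwoCyclicInverse
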